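import Summits.AtomisticToContinuum.FouriersLaw.Theses.HonestZwanzig

/-!
# HonestZwanzig / PositiveMemory — the two floors give the normal form (line `Sketch`, skeleton v10, stub
# `stub_schur0Floor_of_floors`)

Support file for crux item `stmt-AtomisticToContinuum-12694` (`HonestZwanzig.PositiveMemory`, sub-problem
`FouriersLaw`), line `Sketch`, registered stub `stub_schur0Floor_of_floors` (W3):
`EventualGreenKuboFloorSig → BulkBackflowFloor0Sig → Schur0FloorSig`.

Pure real-number bookkeeping (the time integrals are opaque real numbers; no measure theory is used):
* the eventual Green–Kubo floor gives `κ > 0` and `N₀` with `κ·(N−1) ≤ ∫₀^∞corr_N(J,J)` for `N ≥ N₀`, `N ≥ 2`;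
* the existence-free bulk backflow floor at `δ = κ/2` gives `R₀` with
  `∫₀^∞corr_N(J,J)/(N−1) − κ/2 ≤ schur₀(j_b, J)` on every `R₀`-bulk bond `b`;
* with `k₀ = κ/2` and `R = max R₀ N₀`: an `R`-bulk bond `b` (`R ≤ b`, `b + 2 + R ≤ N`) forces `N ≥ N₀` and is
  `R₀`-bulk, so `κ ≤ ∫₀^∞corr_N(J,J)/(N−1)` (`le_div_iff₀`, `0 < N − 1` from `N ≥ 2`) and `k₀ ≤ schur₀(j_b, J)` by
  `linarith`.

No definitions, no named facts, no `sorry`.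
-/

noncomputable section

open MeasureTheory Finset Real Set Filter Topology
open Literature.MathematicalPhysics.KineticTheory.HeatConduction

namespace Summit.AtomisticToContinuum.FouriersLaw.Theorems.HonestZwanzig.PositiveMemory

/-- **Stub v10-E (W3) — the two floors give the normal form** (pure bookkeeping, no limits, no dynamics):
`EventualGreenKuboFloorSig → BulkBackflowFloor0Sig → Schur0FloorSig` with `k₀ = κ/2` and `R = max R₀ N₀` (for `N ≥ N₀`
the GK floor makes `∫₀^∞corr(J,J)/(N−1) ≥ κ`, the backflow floor at `δ = κ/2` does the rest; for `N < N₀` there is no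
`R`-bulk bond). -/
theorem stub_schur0Floor_of_floors :
    (∀ ω₂ lam β γ : ℝ, 0 < ω₂ → 0 < lam → 0 < β → 0 < γ → ∀ T : ℝ, 0 < T →
      ∃ κ : ℝ, 0 < κ ∧ ∃ N₀ : ℕ, ∀ N : ℕ, N₀ ≤ N → 2 ≤ N →
      let P := Literature.MathematicalPhysics.KineticTheory.HeatConduction.pinnedChain ω₂ lam β γ;
      let X := Literature.MathematicalPhysics.KineticTheory.HeatConduction.PhaseSpace N;
      let μ : MeasureTheory.Measure X := P.gibbsMeasure N T;
      let J : X → ℝ := fun z => ∑ i : Fin N, P.bondCurrent N i z;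
      κ * ((N : ℝ) - 1) ≤ ∫ t in Set.Ioi (0 : ℝ),
        ((∫ z, J z * (∫ y, J y ∂(P.transitionKernel N T T t.toNNReal z)) ∂μ) - (∫ z, J z ∂μ) * (∫ z, J z ∂μ))) →
    (∀ ω₂ lam β γ : ℝ, 0 < ω₂ → 0 < lam → 0 < β → 0 < γ → ∀ T : ℝ, 0 < T → ∀ δ : ℝ, 0 < δ → ∃ R : ℕ, ∀ N : ℕ, 2 ≤ N →
      let P := Literature.MathematicalPhysics.KineticTheory.HeatConduction.pinnedChain ω₂ lam β γ
      let X := Literature.MathematicalPhysics.KineticTheory.HeatConduction.PhaseSpace N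
      let μ : MeasureTheory.Measure X := P.gibbsMeasure N T
      let corr : (X → ℝ) → (X → ℝ) → ℝ → ℝ := fun f g t =>
        (∫ z, f z * (∫ y, g y ∂(P.transitionKernel N T T t.toNNReal z)) ∂μ) - (∫ z, f z ∂μ) * (∫ z, g z ∂μ)
      let e : Fin N → X → ℝ := fun x z => z.2 x ^ 2 / 2 + P.U (z.1 x) +
        ∑ j : Fin N, ((if j.val = x.val + 1 then P.V (z.1 j - z.1 x) / 2 else 0) +
          (if x.val = j.val + 1 then P.V (z.1 x - z.1 j) / 2 else 0))
      let J : X → ℝ := fun z => ∑ i : Fin N, P.bondCurrent N i z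
      let G₀ : Matrix (Fin N) (Fin N) ℝ := Matrix.of fun x y => ∫ t in Set.Ioi (0 : ℝ), corr (e x) (e y) t
      let schur₀ : (X → ℝ) → (X → ℝ) → ℝ := fun f g =>
        (∫ t in Set.Ioi (0 : ℝ), corr f g t) -
          ∑ x : Fin N, ∑ y : Fin N, (∫ t in Set.Ioi (0 : ℝ), corr f (e x) t) * G₀⁻¹ x y *
            (∫ t in Set.Ioi (0 : ℝ), corr (e y) g t)
      ∀ b : Fin N, R ≤ b.val → b.val + 2 + R ≤ N →
        (∫ t in Set.Ioi (0 : ℝ), corr J J t) / ((N : ℝ) - 1) - δ ≤ schur₀ (P.bondCurrent N b) J) →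
    ∀ ω₂ lam β γ : ℝ, 0 < ω₂ → 0 < lam → 0 < β → 0 < γ → ∀ T : ℝ, 0 < T → ∃ k₀ : ℝ, 0 < k₀ ∧ ∃ R : ℕ,
      ∀ N : ℕ, 2 ≤ N →
      let P := Literature.MathematicalPhysics.KineticTheory.HeatConduction.pinnedChain ω₂ lam β γ
      let X := Literature.MathematicalPhysics.KineticTheory.HeatConduction.PhaseSpace N
      let μ : MeasureTheory.Measure X := P.gibbsMeasure N T
      let corr : (X → ℝ) → (X → ℝ) → ℝ → ℝ := fun f g t =>
        (∫ z, f z * (∫ y, g y ∂(P.transitionKernel N T T t.toNNReal z)) ∂μ) - (∫ z, f z ∂μ) * (∫ z, g z ∂μ)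
      let e : Fin N → X → ℝ := fun x z => z.2 x ^ 2 / 2 + P.U (z.1 x) +
        ∑ j : Fin N, ((if j.val = x.val + 1 then P.V (z.1 j - z.1 x) / 2 else 0) +
          (if x.val = j.val + 1 then P.V (z.1 x - z.1 j) / 2 else 0))
      let J : X → ℝ := fun z => ∑ i : Fin N, P.bondCurrent N i z
      let G₀ : Matrix (Fin N) (Fin N) ℝ := Matrix.of fun x y => ∫ t in Set.Ioi (0 : ℝ), corr (e x) (e y) t
      let schur₀ : (X → ℝ) → (X → ℝ) → ℝ := fun f g =>
        (∫ t in Set.Ioi (0 : ℝ), corr f g t) -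
          ∑ x : Fin N, ∑ y : Fin N, (∫ t in Set.Ioi (0 : ℝ), corr f (e x) t) * G₀⁻¹ x y *
            (∫ t in Set.Ioi (0 : ℝ), corr (e y) g t)
      ∀ b : Fin N, R ≤ b.val → b.val + 2 + R ≤ N → k₀ ≤ schur₀ (P.bondCurrent N b) J := by
  intro hGK hB ω₂ lam β γ hω hl hβ hγ T hT
  -- the eventual Green–Kubo floor `κ·(N−1) ≤ ∫₀^∞corr_N(J,J)` for `N ≥ N₀`
  obtain ⟨κ, hκ, N₀, hGKN⟩ := hGK ω₂ lam β γ hω hl hβ hγ T hT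
  -- the existence-free bulk backflow floor at `δ = κ/2`
  obtain ⟨R₀, hR₀⟩ := hB ω₂ lam β γ hω hl hβ hγ T hT (κ / 2) (by positivity)
  refine ⟨κ / 2, by positivity, max R₀ N₀, fun N hN => ?_⟩
  intro P X μ corr e J G₀ schur₀ b hRb hbN
  have hm₁ : R₀ ≤ max R₀ N₀ := le_max_left _ _
  have hm₂ : N₀ ≤ max R₀ N₀ := le_max_right _ _
  have hN₀ : N₀ ≤ N := by omega
  have hR₀b : R₀ ≤ b.val := by omega
  have hbN₀ : b.val + 2 + R₀ ≤ N := by omega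
  -- backflow floor on the `R₀`-bulk bond `b`: `∫corr(J,J)/(N−1) − κ/2 ≤ schur₀(j_b, J)`
  have hfloor : (∫ t in Set.Ioi (0 : ℝ), corr J J t) / ((N : ℝ) - 1) - κ / 2 ≤
      schur₀ (P.bondCurrent N b) J :=
    hR₀ N hN b hR₀b hbN₀
  -- Green–Kubo floor at `N ≥ N₀`: `κ·(N−1) ≤ ∫corr(J,J)`
  have hGK' : κ * ((N : ℝ) - 1) ≤ ∫ t in Set.Ioi (0 : ℝ), corr J J t := hGKN N hN₀ hN
  have hpos : (0 : ℝ) < (N : ℝ) - 1 := by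
    have h2 : (2 : ℝ) ≤ N := by exact_mod_cast hN
    linarith
  have hκle : κ ≤ (∫ t in Set.Ioi (0 : ℝ), corr J J t) / ((N : ℝ) - 1) := by
    rw [le_div_iff₀ hpos]
    exact hGK'
  linarith

end Summit.AtomisticToContinuum.FouriersLaw.Theorems.HonestZwanzig.PositiveMemory

end
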